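import Summits.Ventures.PercRepro.S1CoreStarPlane
import Summits.Ventures.PercRepro.S1TriangleCount

/-!
# PercRepro — the cost model of the 4-circuit cap: rank and nullity bounds for a list of rank-`≤ 2` sets
(p1, gen 21; `proofs/P1-S4-PERPOINT.md` §9 (4), §9.1)

For ANY matroid `N` and a list of sets `L` of rank `≤ 2`, added in order, `r(U ∪ L) ≤ r(U) + min(|L ∖ U|, 2 − r(U ∩ L))`
(subadditivity and submodularity), so the union of the list has rank `≤ costSum` (every ordering) and its point count
is at most `costSum + nullity`. Applied to `N := M ／ {e}` (the contraction by a point of the e-free core `M`, whose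
nullity equals `M`'s — night-1's `dual_eRank_contract_singleton`), this is the `cost ≤ ν` clause of the cap search,
in which `r_N(L ∩ U) = min(#parallel classes of N in L ∩ U, 2)` and `|L ∖ U|` counts points.
* `eRk_union_le_eRk_add_min` — the one-step bound;
* `costSum` — `Σ min(|L ∖ U|, 2 − r(L ∩ U))` over the list (head added last);
* **`eRk_sUnion_le_costSum`**, **`ncard_sUnion_le_costSum_add`** — rank `≤ cost`, points `≤ cost + nullity`;
* **`ncard_sUnion_le_costSum_add_of_contract`** — the same for `M ／ {e}` with the nullity of `M`.
Axioms: standard.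
-/

open scoped Matroid

namespace PercRepro

namespace S1

open Set

variable {α : Type}

/-- Adding a set `L` of rank `≤ 2` raises the rank by at most `min(|L ∖ U|, 2 − r(U ∩ L))`. -/
theorem eRk_union_le_eRk_add_min (N : Matroid α) {U L : Set α} (hL : N.eRk L ≤ 2) (hLfin : L.Finite) :
    N.eRk (U ∪ L) ≤ N.eRk U + ((min ((L \ U).ncard) (2 - (N.eRk (U ∩ L)).toNat) : ℕ) : ℕ∞) := by
  have hnew : N.eRk (U ∪ L) ≤ N.eRk U + ((L \ U).ncard : ℕ∞) := by
    have h1 : U ∪ L = U ∪ (L \ U) := (union_sdiff_self).symm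
    rw [h1]
    refine (N.eRk_union_le_eRk_add_eRk _ _).trans (add_le_add (le_refl _) ?_)
    refine (N.eRk_le_encard _).trans (le_of_eq ?_)
    rw [Set.Finite.cast_ncard_eq (hLfin.subset sdiff_subset)]
  have hrUL : N.eRk (U ∩ L) ≠ ⊤ := ne_top_of_le_ne_top (by simp : (2 : ℕ∞) ≠ ⊤) ((N.eRk_mono inter_subset_right).trans hL)
  obtain ⟨k, hk⟩ := ENat.ne_top_iff_exists.1 hrUL
  have hold : N.eRk (U ∪ L) ≤ N.eRk U + ((2 - (N.eRk (U ∩ L)).toNat : ℕ) : ℕ∞) := by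
    have hsub := N.eRk_inter_add_eRk_union_le U L
    have hk2 : k ≤ 2 := by
      have := (N.eRk_mono (inter_subset_right : U ∩ L ⊆ L)).trans hL
      rw [← hk] at this; exact_mod_cast this
    rw [← hk, ENat.toNat_coe]
    have h3 : (k : ℕ∞) + N.eRk (U ∪ L) ≤ N.eRk U + 2 := by
      calc (k : ℕ∞) + N.eRk (U ∪ L) = N.eRk (U ∩ L) + N.eRk (U ∪ L) := by rw [hk]
        _ ≤ N.eRk U + N.eRk L := hsub
        _ ≤ N.eRk U + 2 := add_le_add (le_refl _) hL
    have h4 : (k : ℕ∞) + N.eRk (U ∪ L) ≤ k + (N.eRk U + ((2 - k : ℕ) : ℕ∞)) := by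
      refine h3.trans (le_of_eq ?_)
      have : ((2 - k : ℕ) : ℕ∞) + (k : ℕ∞) = 2 := by
        rw [← Nat.cast_add, Nat.sub_add_cancel hk2]; rfl
      calc N.eRk U + 2 = N.eRk U + (((2 - k : ℕ) : ℕ∞) + k) := by rw [this]
        _ = k + (N.eRk U + ((2 - k : ℕ) : ℕ∞)) := by abel
    exact (ENat.add_le_add_iff_left (by simp)).1 h4
  rcases Nat.le_total ((L \ U).ncard) (2 - (N.eRk (U ∩ L)).toNat) with hle | hle
  · rw [Nat.min_eq_left hle]; exact hnew
  · rw [Nat.min_eq_right hle]; exact hold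

/-- The COST of a list of rank-`≤ 2` sets, in the order in which they are added (the head is added LAST):
`costSum N (L :: rest) = costSum N rest + min(|L ∖ U|, 2 − r_N(L ∩ U))` with `U := ⋃₀ rest`. -/
noncomputable def costSum (N : Matroid α) : List (Set α) → ℕ
  | [] => 0
  | L :: rest => costSum N rest +
      min ((L \ ⋃₀ {S | S ∈ rest}).ncard) (2 - (N.eRk ((⋃₀ {S | S ∈ rest}) ∩ L)).toNat)

/-- **The rank bound of the cost model**: a list of finite sets of rank `≤ 2` spans rank at most its cost (for EVERY
ordering; the search takes the minimum). -/
theorem eRk_sUnion_le_costSum (N : Matroid α) :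
    ∀ ls : List (Set α), (∀ L ∈ ls, L.Finite ∧ N.eRk L ≤ 2) →
      N.eRk (⋃₀ {S | S ∈ ls}) ≤ (costSum N ls : ℕ∞)
  | [], _ => by simp [costSum]
  | L :: rest, h => by
    have hrest := eRk_sUnion_le_costSum N rest (fun S hS => h S (List.mem_cons_of_mem _ hS))
    have hL := h L List.mem_cons_self
    set U := ⋃₀ {S | S ∈ rest} with hU
    have hunion : ⋃₀ {S | S ∈ L :: rest} = U ∪ L := by
      ext t; simp only [mem_sUnion, mem_setOf_eq, List.mem_cons, mem_union, hU]
      constructor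
      · rintro ⟨S, hS | hS, htS⟩
        · exact Or.inr (hS ▸ htS)
        · exact Or.inl ⟨S, hS, htS⟩
      · rintro (⟨S, hS, htS⟩ | htL)
        · exact ⟨S, Or.inr hS, htS⟩
        · exact ⟨L, Or.inl rfl, htL⟩
    rw [hunion]
    simp only [costSum]
    calc N.eRk (U ∪ L) ≤ N.eRk U + ((min ((L \ U).ncard) (2 - (N.eRk (U ∩ L)).toNat) : ℕ) : ℕ∞) :=
          eRk_union_le_eRk_add_min N hL.2 hL.1
      _ ≤ (costSum N rest : ℕ∞) + ((min ((L \ U).ncard) (2 - (N.eRk (U ∩ L)).toNat) : ℕ) : ℕ∞) :=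
          add_le_add hrest (le_refl _)
      _ = ((costSum N rest + min ((L \ U).ncard) (2 - (N.eRk (U ∩ L)).toNat) : ℕ) : ℕ∞) := by push_cast; rfl

/-- **The nullity bound of the cost model**: on a finite matroid of nullity `d`, the points on the listed sets number
at most `costSum + d`. -/
theorem ncard_sUnion_le_costSum_add (N : Matroid α) [N.Finite] {d : ℕ} (hd : N.E.encard = N.eRank + d)
    (ls : List (Set α)) (hls : ∀ L ∈ ls, L ⊆ N.E ∧ N.eRk L ≤ 2) :
    (⋃₀ {S | S ∈ ls}).ncard ≤ costSum N ls + d := by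
  set V := ⋃₀ {S | S ∈ ls} with hV
  have hVE : V ⊆ N.E := by
    intro t ht
    obtain ⟨S, hS, htS⟩ := mem_sUnion.1 ht
    exact (hls S hS).1 htS
  have hVfin : V.Finite := N.ground_finite.subset hVE
  have hr := eRk_sUnion_le_costSum N ls
    (fun S hS => ⟨N.ground_finite.subset (hls S hS).1, (hls S hS).2⟩)
  rw [← hV] at hr
  have hEV : N.E.ncard = V.ncard + (N.E \ V).ncard := by
    have := ncard_sdiff_add_ncard_of_subset hVE N.ground_finite
    omega
  have hrE : N.eRank ≤ N.eRk V + ((N.E \ V).ncard : ℕ∞) := by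
    rw [_root_.Matroid.eRank_def]
    have h1 : N.E = V ∪ (N.E \ V) := (union_sdiff_cancel hVE).symm
    conv_lhs => rw [h1]
    refine (N.eRk_union_le_eRk_add_eRk _ _).trans (add_le_add (le_refl _) ?_)
    refine (N.eRk_le_encard _).trans (le_of_eq ?_)
    rw [Set.Finite.cast_ncard_eq (N.ground_finite.subset sdiff_subset)]
  obtain ⟨r, hr'⟩ := ENat.ne_top_iff_exists.1 (PercRepro.Matroid.eRank_ne_top_of_finite N)
  have hn : N.E.ncard = r + d := by
    have := hd
    rw [← hr', ← Set.Finite.cast_ncard_eq N.ground_finite] at this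
    exact_mod_cast this
  have hrV : N.eRk V ≠ ⊤ := ne_top_of_le_ne_top (ENat.coe_ne_top _) hr
  obtain ⟨rV, hrV'⟩ := ENat.ne_top_iff_exists.1 hrV
  have h1 : r ≤ rV + (N.E \ V).ncard := by
    have := hrE
    rw [← hr', ← hrV'] at this
    exact_mod_cast this
  have h2 : rV ≤ costSum N ls := by
    have := hr
    rw [← hrV'] at this
    exact_mod_cast this
  omega

/-- **The cap's cost clause**: for a point `e` of a finite matroid `M` of nullity `d` (`e` a non-loop), the points of
`M ／ {e}` on a list of sets of contraction-rank `≤ 2` (the lines of `N = M ／ {e}`) number at most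
`costSum (M ／ {e}) ls + d`. -/
theorem ncard_sUnion_le_costSum_add_of_contract (M : Matroid α) [M.Finite] {d : ℕ}
    (hd : M.E.encard = M.eRank + d) {e : α} (he : M.Indep {e}) (ls : List (Set α))
    (hls : ∀ L ∈ ls, L ⊆ (M ／ {e}).E ∧ (M ／ {e}).eRk L ≤ 2) :
    (⋃₀ {S | S ∈ ls}).ncard ≤ costSum (M ／ {e}) ls + d := by
  have hν : M✶.eRank = (d : ℕ∞) := by
    have h := _root_.Matroid.eRank_add_eRank_dual M
    rw [hd] at h
    exact WithTop.add_left_cancel (PercRepro.Matroid.eRank_ne_top_of_finite M) h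
  have hν' : (M ／ {e})✶.eRank = (d : ℕ∞) := by
    rw [PercRepro.Matroid.dual_eRank_contract_singleton he, hν]
  have hd' : (M ／ {e}).E.encard = (M ／ {e}).eRank + d := by
    have h := _root_.Matroid.eRank_add_eRank_dual (M ／ {e})
    rw [hν'] at h
    exact h.symm
  exact ncard_sUnion_le_costSum_add (M ／ {e}) hd' ls hls

end S1

end PercRepro
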